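import Literature.Geometry.Riemannian.HeatBarrierSubsolutionFamily
import Literature.Geometry.Riemannian.DistSqBasepointDatum
import Literature.Geometry.Riemannian.HeatKernelTimeRegularity
import Literature.Geometry.Riemannian.L2ToponogovSmoothFunction
import HarnessLib

/-!
# Displacement of the heat flow of a fixed metric with `Ric ≥ 0`:
# `∫ d(x, ·)² dν_{x,t;s} ≤ 2m (t − s)` and `|P_τ u − u| ≤ Lip(u) √(2mτ)`

For the heat kernel measures `ν_{x,t;s}` of the constant family `r ↦ g` of a closed Riemannian
`m`-manifold with `Ric ≥ 0` (Bamler 2020a, §2.3 for the vocabulary; the estimate is the classical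
second-moment bound of the heat kernel from the Laplacian comparison `Δ d_x² ≤ 2m`, e.g.
Cheeger–Colding / Colding 1996a, §1, in the smoothing step of the volume sphere theorem):

* `neg_distSq_directional_datum` — `u = −d(x, ·)²` has, at every point, lower directional barriers
  with `−Σ bᵢ ≤ 2m + η` (at `y ≠ x` the polynomial barriers of `end_distSq_barriers_linear`,
  `Σ bᵢ ≤ 2m − 2T∫(s/T)² Ric(γ̇,γ̇) + η ≤ 2m + η` under `Ric ≥ 0`; at `y = x` the barrier `−σ²`);
* **`integral_distSq_heatKernelMeasure_le`** — `∫ d(x, y)² dν_{x,t;s}(y) ≤ 2m (t − s)` for `s < t`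
  (the barrier sub-solution domination `integral_heatKernelMeasure_le_of_directionalBarrier_static`
  with `c = 2m`, and `ν_{x,t;s₂} → δ_x` as `s₂ ↗ t`);
* **`abs_heatValueC_sub_self_le_of_lipschitz`** — for `u` `Lip`-Lipschitz for `d_g`,
  `|(P_{s→t} u)(x) − u(x)| ≤ Lip √(2m (t − s))` (Cauchy–Schwarz against the probability measure
  `ν_{x,t;s}`).

Purpose: `sup |P_τ cos d_p − cos d_p| ≤ √(2mτ)` in the smoothing step of Colding's proof of the
volume sphere theorem (`Colding1996_volume_ghClose`). Everything here is proved; no definitions,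
no named facts (D-0026).

## References

* T. H. Colding, *Shape of manifolds with positive Ricci curvature*, Invent. Math. 124 (1996)
  175–191, §1. [Colding1996Shape]
* R. H. Bamler, *Entropy and heat kernel bounds on a Ricci flow background* (2020), §2.3.
  [Bamler2020Entropy]
* J. M. Lee, *Introduction to Riemannian Manifolds* (2018), Thm. 11.15 (Laplacian comparison).
  [LeeRiemannianManifolds2018]
-/

noncomputable section

open Set Function Filter MeasureTheory Measure
open scoped Manifold ContDiff Topology ENNReal NNReal

namespace Literature.Geometry.Riemannian

open Lorentzian Lorentzian.PseudoRiemannianMetric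

section Static

variable {m : ℕ} {M : Type*} [TopologicalSpace M] [ChartedSpace (EuclideanSpace ℝ (Fin m)) M]
  [IsManifold 𝓘(ℝ, EuclideanSpace ℝ (Fin m)) ∞ M] [T2Space M] [CompactSpace M] [ConnectedSpace M]
  [SecondCountableTopology M] [MeasurableSpace M] [BorelSpace M]
  (g : PseudoRiemannianMetric 𝓘(ℝ, EuclideanSpace ℝ (Fin m)) ∞ (EuclideanSpace ℝ (Fin m))
    (TangentSpace 𝓘(ℝ, EuclideanSpace ℝ (Fin m)) : M → Type _)) [g.HasLeviCivita]

omit [SecondCountableTopology M] [MeasurableSpace M] [BorelSpace M] [g.HasLeviCivita] in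
/-- `y ↦ d(x, y)` (real-valued) is continuous on a closed connected Riemannian manifold. [folklore] -/
theorem continuous_edist_toReal (hg : g.IsRiemannian) (x : M) :
    Continuous fun y : M ↦ (g.edist hg x y).toReal :=
  ENNReal.continuousOn_toReal.comp_continuous
    ((PseudoRiemannianMetric.continuous_edist hg).comp (Continuous.prodMk_right x))
    fun y ↦ PseudoRiemannianMetric.edist_ne_top hg x y

omit [SecondCountableTopology M] [MeasurableSpace M] [BorelSpace M] in
/-- **The lower directional datum of `−d(x, ·)²` under `Ric ≥ 0`** (Laplacian comparison
`Δ d_x² ≤ 2m` in the barrier sense, at EVERY point, cut locus included): for every `y` and `η > 0`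
a `g`-orthonormal frame `e` at `y` and one-variable lower barriers `Bᵢ(σ) ≤ −d(x, exp_y(σeᵢ))²`
near `σ = 0`, touching, with second derivatives `bᵢ` at `0` and `−Σᵢ bᵢ ≤ 2m + η` — at `y ≠ x`
minus the polynomial upper barriers of `end_distSq_barriers_linear` along a minimising geodesic
(`Σ ≤ 2m − 2T∫₀ᵀ(s/T)² Ric(γ̇,γ̇) + η ≤ 2m + η`), at `y = x` the barriers `−σ²`.
[cite: LeeRiemannianManifolds2018, Thm. 11.15] -/
theorem neg_distSq_directional_datum (hg : g.IsRiemannian)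
    (hRic : ∀ (z : M) (w : TangentSpace 𝓘(ℝ, EuclideanSpace ℝ (Fin m)) z),
      0 ≤ g.leviCivita.ricci z w w)
    (x y : M) {η : ℝ} (hη : 0 < η) :
    ∃ (e : Fin (Module.finrank ℝ (EuclideanSpace ℝ (Fin m))) →
        TangentSpace 𝓘(ℝ, EuclideanSpace ℝ (Fin m)) y)
      (B B' : Fin (Module.finrank ℝ (EuclideanSpace ℝ (Fin m))) → ℝ → ℝ)
      (b : Fin (Module.finrank ℝ (EuclideanSpace ℝ (Fin m))) → ℝ),
      (∀ i j, g.val y (e i) (e j) = if i = j then 1 else 0) ∧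
      (∀ i, (∀ᶠ σ in 𝓝 (0 : ℝ), HasDerivAt (B i) (B' i σ) σ) ∧ HasDerivAt (B' i) (b i) 0 ∧
        B i 0 = -((g.edist hg x y).toReal ^ 2) ∧
        ∀ᶠ σ in 𝓝 (0 : ℝ), B i σ ≤
          -((g.edist hg x (expMap g.leviCivita y (σ • e i))).toReal ^ 2)) ∧
      -(∑ i, b i) ≤ 2 * m + η := by
  classical
  haveI : Fact ((1 : ℕ∞ω) ≤ ((⊤ : ℕ∞) : ℕ∞ω)) := ⟨by exact_mod_cast le_top⟩
  have h2 : (2 : ℕ∞ω) ≤ ((⊤ : ℕ∞) : ℕ∞ω) := WithTop.coe_le_coe.mpr le_top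
  haveI : CovariantDerivative.ContMDiffCovariantDerivative g.leviCivita 1 :=
    contMDiffCovariantDerivative_leviCivita_of_two_le g h2
  haveI : CovariantDerivative.ContMDiffCovariantDerivative g.leviCivita ((⊤ : ℕ∞) : ℕ∞ω) :=
    contMDiffCovariantDerivative_leviCivita_infty g le_rfl
  have hc : IsGeodesicallyComplete g.leviCivita := isGeodesicallyComplete_of_compactSpace g h2 hg
  have hfr : ((Module.finrank ℝ (EuclideanSpace ℝ (Fin m)) : ℕ) : ℝ) = m := by
    rw [finrank_euclideanSpace_fin]
  by_cases hxy : x = y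
  · /- at `x` itself: the barriers `-σ²` -/
    subst hxy
    obtain ⟨bs, hbs⟩ := g.exists_orthonormal_basis x hg
    have hd0 : (g.edist hg x x).toReal ^ 2 = 0 := by
      rw [PseudoRiemannianMetric.edist_self]; simp
    have hsq : ∀ σ : ℝ, HasDerivAt (fun σ : ℝ ↦ -(σ ^ 2)) (-(2 * σ)) σ := fun σ ↦
      ((hasDerivAt_pow 2 σ).neg).congr_deriv (by ring)
    have h2σ : HasDerivAt (fun σ : ℝ ↦ -(2 * σ)) (-2) 0 := by
      have h1 := ((hasDerivAt_id (0 : ℝ)).const_mul 2).neg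
      have h2 : (fun σ : ℝ ↦ -(2 * σ)) = fun y ↦ -(2 * id y) := by funext y; simp only [id]
      rw [h2]
      exact h1.congr_deriv (by simp)
    have hdom : ∀ i, ∀ σ : ℝ,
        (g.edist hg x (expMap g.leviCivita x (σ • bs i))).toReal ^ 2 ≤ σ ^ 2 := by
      intro i σ
      have h1 := (edist_expMap_smul_toReal_le_abs g hg hc x (bs i) (by rw [hbs]; simp) σ).2
      calc (g.edist hg x (expMap g.leviCivita x (σ • bs i))).toReal ^ 2 ≤ |σ| ^ 2 :=
            pow_le_pow_left₀ ENNReal.toReal_nonneg h1 2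
        _ = σ ^ 2 := sq_abs σ
    refine ⟨fun i ↦ bs i, fun _ σ ↦ -(σ ^ 2), fun _ σ ↦ -(2 * σ), fun _ ↦ -2, hbs,
      fun i ↦ ⟨Eventually.of_forall hsq, h2σ, by rw [hd0]; simp, ?_⟩, ?_⟩
    · exact Eventually.of_forall fun σ ↦ neg_le_neg (hdom i σ)
    · simp only [Finset.sum_const, Finset.card_univ, Fintype.card_fin, smul_neg, nsmul_eq_mul,
        hfr, neg_neg]
      linarith
  · /- at `y ≠ x`: minus the upper barriers of `d_x²` along a minimising geodesic -/
    obtain ⟨v, T, hTpos, hv, hyTv, hT⟩ := exists_unit_minimizing g hg hc hxy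
    subst hyTv
    obtain ⟨e, B, B', b, hon, hB, hsum⟩ := end_distSq_barriers_linear g hg hc x v hv hTpos hη
    -- `Ric ≥ 0` along the geodesic
    have hI : 0 ≤ ∫ s in (0 : ℝ)..T, (s / T) ^ 2 *
        g.leviCivita.ricci (expMap g.leviCivita x (s • v))
          (velocity 𝓘(ℝ, EuclideanSpace ℝ (Fin m)) (fun t ↦ expMap g.leviCivita x (t • v)) s)
          (velocity 𝓘(ℝ, EuclideanSpace ℝ (Fin m)) (fun t ↦ expMap g.leviCivita x (t • v)) s) :=
      intervalIntegral.integral_nonneg hTpos.le fun s _ ↦ mul_nonneg (sq_nonneg _) (hRic _ _)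
    rw [hfr] at hsum
    refine ⟨e, fun i σ ↦ -(B i σ), fun i σ ↦ -(B' i σ), fun i ↦ -(b i), hon, fun i ↦ ?_, ?_⟩
    · obtain ⟨hd1, hd2, hB0, hdom⟩ := hB i
      refine ⟨hd1.mono fun σ hσ ↦ hσ.neg, hd2.neg, by simp only [hB0, hT], ?_⟩
      exact hdom.mono fun σ hσ ↦ neg_le_neg hσ
    · rw [Finset.sum_neg_distrib, neg_neg]
      nlinarith [hsum, hI, hTpos]

/-- **`∫ d(x, y)² dν_{x,t;s}(y) ≤ 2m (t − s)`** for the heat kernel measures of the constant family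
of a closed Riemannian `m`-manifold with `Ric ≥ 0` and `s < t` (the barrier sub-solution
`−d_x²`, `Δ(−d_x²) ≥ −2m`, is dominated: `∫ −d_x² dν_{x,t;s₂} ≤ ∫ −d_x² dν_{x,t;s} + 2m(s₂ − s)`,
`integral_heatKernelMeasure_le_of_directionalBarrier_static`; let `s₂ ↗ t`, `ν_{x,t;s₂} → δ_x`).
[cite: Bamler2020Entropy, §2.3] [cite: Colding1996Shape, §1] -/
theorem integral_distSq_heatKernelMeasure_le (hg : g.IsRiemannian)
    (hRic : ∀ (z : M) (w : TangentSpace 𝓘(ℝ, EuclideanSpace ℝ (Fin m)) z),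
      0 ≤ g.leviCivita.ricci z w w)
    (hh : IsContMDiffFamilyOn ∞ (fun _ : ℝ ↦ g) univ) (hR : ∀ _ : ℝ, g.IsRiemannian)
    (x : M) {s t : ℝ} (hst : s < t) :
    ∫ y, (g.edist hg x y).toReal ^ 2 ∂(heatKernelMeasure hh hR t x s) ≤ 2 * m * (t - s) := by
  set u : M → ℝ := fun y ↦ -((g.edist hg x y).toReal ^ 2) with hu
  have huc : Continuous u := ((continuous_edist_toReal g hg x).pow 2).neg
  -- domination for `s < s₂ < t`
  have hstep : ∀ s₂ ∈ Ioo s t, ∫ y, u y ∂(heatKernelMeasure hh hR t x s₂) ≤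
      ∫ y, u y ∂(heatKernelMeasure hh hR t x s) + 2 * m * (s₂ - s) := fun s₂ hs₂ ↦
    integral_heatKernelMeasure_le_of_directionalBarrier_static hh hR x hs₂.1 hs₂.2 huc
      (c := 2 * m) fun y _ _ η hη ↦ neg_distSq_directional_datum g hg hRic x y hη
  -- the limit `s₂ ↗ t`
  have hcont : Continuous fun s' ↦ ∫ y, u y ∂(heatKernelMeasure hh hR t x s') - 2 * m * (s' - s) :=
    (continuous_integral_heatKernelMeasure_left hh hR t x huc).sub (by fun_prop)
  have hev : ∀ᶠ s' in 𝓝[<] t, ∫ y, u y ∂(heatKernelMeasure hh hR t x s') - 2 * m * (s' - s) ≤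
      ∫ y, u y ∂(heatKernelMeasure hh hR t x s) := by
    filter_upwards [Ioo_mem_nhdsLT hst] with s' hs'
    linarith [hstep s' hs']
  have hlim := le_of_tendsto (hcont.continuousAt.tendsto.mono_left nhdsWithin_le_nhds) hev
  have h0 : ∫ y, u y ∂(heatKernelMeasure hh hR t x t) = 0 := by
    rw [heatKernelMeasure_self hh hR, integral_dirac]
    simp [hu, PseudoRiemannianMetric.edist_self]
  rw [h0] at hlim
  have hneg : ∫ y, (g.edist hg x y).toReal ^ 2 ∂(heatKernelMeasure hh hR t x s) =
      -∫ y, u y ∂(heatKernelMeasure hh hR t x s) := by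
    rw [← integral_neg]
    simp [hu]
  rw [hneg]
  linarith

/-- **Displacement of the heat propagation on Lipschitz data**: on a closed Riemannian
`m`-manifold with `Ric ≥ 0`, for `u` continuous and `Lip`-Lipschitz for `d_g` and `s < t`,
  `|(P_{s→t} u)(x) − u(x)| ≤ Lip √(2m (t − s))`
(`P_{s→t}u(x) − u(x) = ∫ (u − u(x)) dν_{x,t;s}`, `|u(y) − u(x)| ≤ Lip d(x, y)`, Cauchy–Schwarz for the
probability measure `ν_{x,t;s}`, and `integral_distSq_heatKernelMeasure_le`).
[cite: Colding1996Shape, §1] [cite: Bamler2020Entropy, §2.3] -/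
theorem abs_heatValueC_sub_self_le_of_lipschitz (hg : g.IsRiemannian)
    (hRic : ∀ (z : M) (w : TangentSpace 𝓘(ℝ, EuclideanSpace ℝ (Fin m)) z),
      0 ≤ g.leviCivita.ricci z w w)
    {u : M → ℝ} (huc : Continuous u) {Lip : ℝ} (hLip : 0 ≤ Lip)
    (hlip : ∀ y z, |u y - u z| ≤ Lip * (g.edist hg y z).toReal) (x : M) {s t : ℝ} (hst : s < t) :
    |heatValueC (fun _ : ℝ ↦ g) s t x u - u x| ≤ Lip * Real.sqrt (2 * m * (t - s)) := by
  have hh : IsContMDiffFamilyOn ∞ (fun _ : ℝ ↦ g) univ := isContMDiffFamilyOn_const g univ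
  have hR : ∀ _ : ℝ, g.IsRiemannian := fun _ ↦ hg
  set ν : Measure M := heatKernelMeasure hh hR t x s with hν
  have hd := continuous_edist_toReal g hg x
  have hi : ∀ {f : M → ℝ}, Continuous f → Integrable f ν := fun hf ↦
    hf.integrable_of_hasCompactSupport (HasCompactSupport.of_compactSpace _)
  rw [← integral_heatKernelMeasure hh hR hst x huc]
  have h1 : ∫ y, u y ∂ν - u x = ∫ y, (u y - u x) ∂ν := by
    rw [integral_sub (hi huc) (integrable_const _), integral_const, probReal_univ, one_smul]
  rw [h1]
  calc |∫ y, (u y - u x) ∂ν| ≤ ∫ y, |u y - u x| ∂ν := abs_integral_le_integral_abs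
    _ ≤ ∫ y, Lip * (g.edist hg x y).toReal ∂ν := by
        refine integral_mono (hi (huc.sub continuous_const)).abs (hi (hd.const_mul Lip))
          fun y ↦ ?_
        rw [PseudoRiemannianMetric.edist_comm]
        exact hlip y x
    _ = Lip * ∫ y, (g.edist hg x y).toReal ∂ν := integral_const_mul _ _
    _ ≤ Lip * Real.sqrt ((ν univ).toReal * ∫ y, (g.edist hg x y).toReal ^ 2 ∂ν) :=
        mul_le_mul_of_nonneg_left
          (integral_le_sqrt_measure_mul_integral_sq (hi hd) (hi (hd.pow 2))) hLip
    _ ≤ Lip * Real.sqrt (2 * m * (t - s)) := by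
        refine mul_le_mul_of_nonneg_left (Real.sqrt_le_sqrt ?_) hLip
        rw [measure_univ, ENNReal.toReal_one, one_mul]
        exact integral_distSq_heatKernelMeasure_le g hg hRic hh hR x hst

end Static

end Literature.Geometry.Riemannian

end
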